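import Literature.NumberTheory.EllipticCurves.NewformsMainLemmaTraceProofs
import Literature.NumberTheory.EllipticCurves.ModularSymbolsPeriodHomology
import HarnessLib
/-!
# Transfer of cycles: `(Tr^L_N)^∨ H₁(X₀(N), ℤ) ⊆ H₁(X₀(L), ℤ)` (route `EdixhovenFibreFiveSeven`, crux TDS57,
# `--supports`; ROAD A′ = Ihara-free L-TWIST, part 1)

Cell `pub/bsd-wall` (D-0145 line `route-BirchSwinnertonDyer-EdixhovenFibreFiveSeven`), seat `bsd-line-edix-p3`
(prover). Route-free file: THEOREMS ONLY (no definition, no named fact, no `sorry`). BSD is not proved by this file.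

For `N ∣ L` the trace `Tr^L_N = [Γ₀(L) 1 Γ₀(N)] : S₂(Γ₀(L)) → S₂(Γ₀(N))` (`restrictLevel`) has transpose
`(Tr^L_N)^∨ : S₂(Γ₀(N))^∨ → S₂(Γ₀(L))^∨`, the TRANSFER (pull-back of cycles along `X₀(L) → X₀(N)`). We prove that
it carries the period homology `H₁(X₀(N), ℤ)` into `H₁(X₀(L), ℤ)`:
for `γ ∈ Γ₀(N)` and right coset representatives `Γ₀(N) = ⊔ᵢ Γ₀(L) rᵢ`,
`{∞, γ∞}_{Tr h} = ∑ᵢ {∞, δᵢ∞}_h` with `rᵢ γ = δᵢ r_{σ i}`, `δᵢ ∈ Γ₀(L)`, `σ` a permutation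
(`cuspSymbol_restrictLevel_eq_sum`): `{∞,γ∞}_{Tr h} = V_{Tr h}(γτ) − V_{Tr h}(τ) = ∑ᵢ (V_h(rᵢγτ) − V_h(rᵢτ))`
(Manin's `τ`-independence of `V_h(gτ) − V_{h∣g}(τ)`, tree `verticalIntegral_smul_sub_eq`) and
`V_h(δᵢ r_{σ i} τ) = V_h(r_{σ i}τ) + {∞, δᵢ∞}_h` (tree `eichlerIntegral_smul_sub_holds`).

References: [Shimura1971] §3.4 (3.4.4), Prop. 3.38, §7.2 (7.2.6); [CremonaAlgorithms1997] §2.1 Prop. 2.1.1, §2.4;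
[Manin1972] Prop. 1.4.
-/

set_option autoImplicit false
-- the Theorems directory repeats the summit name (sibling precedent `SignedBaseChangeAssembly.lean`)
set_option linter.dupNamespace false

noncomputable section

open scoped MatrixGroups ModularForm

open CongruenceSubgroup UpperHalfPlane Matrix.SpecialLinearGroup MeasureTheory

namespace Summit.BirchSwinnertonDyer.BirchSwinnertonDyer.Theorems.LTwistTransfer

open Literature.NumberTheory.EllipticCurves.ModularForms

variable {N L : ℕ} [NeZero N] [NeZero L]

/-! ### §1 Coset bookkeeping for `Γ₀(N) = ⊔ᵢ Γ₀(L) rᵢ` -/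

section Cosets

variable {ι : Type*} {α : ι → GL (Fin 2) ℝ}

omit [NeZero N] [NeZero L] in
/-- Each representative of `Γ₀(L) · 1 · Γ₀(N) = Γ₀(N)` (`N ∣ L`) is the image of an element of `Γ₀(N)`.
[folklore] -/
theorem exists_rep_eq_mapGL (hNL : N ∣ L)
    (h : IsDoubleCosetDecomp ((Gamma0 L : Subgroup SL(2, ℤ)) : Subgroup (GL (Fin 2) ℝ))
      ((Gamma0 N : Subgroup SL(2, ℤ)) : Subgroup (GL (Fin 2) ℝ)) 1 α) (i : ι) :
    ∃ r : SL(2, ℤ), r ∈ Gamma0 N ∧ (mapGL ℝ r : GL (Fin 2) ℝ) = α i := by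
  obtain ⟨a, ha, b, hb, hab⟩ := DoubleCoset.mem_doubleCoset.mp (h.mem i)
  have hmem : α i ∈ ((Gamma0 N : Subgroup SL(2, ℤ)) : Subgroup (GL (Fin 2) ℝ)) := by
    rw [hab, mul_one]
    exact Subgroup.mul_mem _ (Gamma0GL_le_of_dvd hNL ha) hb
  obtain ⟨r, hr, hrα⟩ := hmem
  exact ⟨r, hr, hrα⟩

/-- Membership in the image of `Γ₀(K)` in `GL(2, ℝ)` of the image of an element of `SL(2, ℤ)`. [folklore] -/
theorem mapGL_mem_iff {K : ℕ} (r : SL(2, ℤ)) :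
    (mapGL ℝ r : GL (Fin 2) ℝ) ∈ ((Gamma0 K : Subgroup SL(2, ℤ)) : Subgroup (GL (Fin 2) ℝ)) ↔
      r ∈ Gamma0 K :=
  Subgroup.mem_map_iff_mem Matrix.SpecialLinearGroup.mapGL_injective

end Cosets

/-! ### §2 Vertical-ray integrals of finite sums -/

/-- `V_{∑ φᵢ}(τ) = ∑ V_{φᵢ}(τ)` for functions integrable along the vertical ray above `τ`. [folklore] -/
theorem verticalIntegral_finset_sum {ι : Type*} (s : Finset ι) (φ : ι → ℍ → ℂ) (τ : ℍ)
    (hφ : ∀ i ∈ s, IntegrableOn (fun t : ℝ ↦ φ i (ofComplex ((τ : ℂ) + t * Complex.I))) (Set.Ioi 0)) :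
    verticalIntegral (∑ i ∈ s, φ i) τ = ∑ i ∈ s, verticalIntegral (φ i) τ := by
  simp only [verticalIntegral, Finset.sum_apply]
  rw [integral_finsetSum s hφ, Finset.mul_sum]

/-! ### §3 The transfer on period functionals -/

section Transfer

variable {ι : Type*} [Fintype ι] {α : ι → GL (Fin 2) ℝ}

/-- **`{∞, γ∞}_{Tr h} = ∑ᵢ {∞, δᵢ∞}_h`.** Let `N ∣ L`, `Γ₀(N) = ⊔ᵢ Γ₀(L) rᵢ` (a right coset decomposition,
`IsDoubleCosetDecomp … 1 α` with `α i = rᵢ`), and `γ ∈ Γ₀(N)`. Then there are `δᵢ ∈ Γ₀(L)` (namely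
`δᵢ = rᵢ γ r_{σ i}⁻¹` for the permutation `σ` with `rᵢ γ ∈ Γ₀(L) r_{σ i}`) such that for EVERY `h ∈ S₂(Γ₀(L))`
the period of the trace `Tr^L_N h = ∑ᵢ h ∣ rᵢ` over `{∞, γ∞}` is `∑ᵢ {∞, δᵢ∞}_h` — the transfer of the cycle
`{τ, γτ}` of `X₀(N)` to `X₀(L)` (Shimura 1971 (7.2.6); Cremona 1997 §2.4: `⟨{α,β}, f ∣ ∑ Mᵢ⟩ = ⟨∑ Mᵢ{α,β}, f⟩`).
[cite: Shimura1971, §7.2 (7.2.6)] [cite: CremonaAlgorithms1997, §2.4 (2.4.1)] -/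
theorem exists_cuspSymbol_restrictLevel_eq_sum (hNL : N ∣ L)
    (h : IsDoubleCosetDecomp ((Gamma0 L : Subgroup SL(2, ℤ)) : Subgroup (GL (Fin 2) ℝ))
      ((Gamma0 N : Subgroup SL(2, ℤ)) : Subgroup (GL (Fin 2) ℝ)) 1 α) (γ : Gamma0 N) :
    ∃ δ : ι → Gamma0 L, ∀ f : CuspForm (Gamma0 L) 2,
      cuspSymbol (restrictLevel (Gamma0 L) (Gamma0 N) 2 f) γ = ∑ i, cuspSymbol f (δ i) := by
  classical
  -- representatives in `SL(2, ℤ)`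
  choose r hr hrα using exists_rep_eq_mapGL hNL h
  -- the permutation `σ`: `rᵢ γ ∈ Γ₀(L) r_{σ i}`
  have hmemN : ∀ i, (mapGL ℝ (r i * (γ : SL(2, ℤ))) : GL (Fin 2) ℝ) ∈
      ((Gamma0 N : Subgroup SL(2, ℤ)) : Subgroup (GL (Fin 2) ℝ)) :=
    fun i ↦ Subgroup.mem_map_of_mem _ (Subgroup.mul_mem _ (hr i) γ.2)
  have hdc : ∀ i, (mapGL ℝ (r i * (γ : SL(2, ℤ))) : GL (Fin 2) ℝ) ∈
      DoubleCoset.doubleCoset (1 : GL (Fin 2) ℝ) (((Gamma0 L : Subgroup SL(2, ℤ)) : Subgroup (GL (Fin 2) ℝ)))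
        (((Gamma0 N : Subgroup SL(2, ℤ)) : Subgroup (GL (Fin 2) ℝ))) :=
    fun i ↦ DoubleCoset.mem_doubleCoset.mpr ⟨1, Subgroup.one_mem _, _, hmemN i, by rw [one_mul, one_mul]⟩
  choose σ hσ hσu using fun i ↦ h.existsUnique _ (hdc i)
  -- `δᵢ = rᵢ γ r_{σ i}⁻¹ ∈ Γ₀(L)`
  have hδmem' : ∀ i j, (mapGL ℝ (r i * (γ : SL(2, ℤ))) : GL (Fin 2) ℝ) * (α j)⁻¹ ∈
      ((Gamma0 L : Subgroup SL(2, ℤ)) : Subgroup (GL (Fin 2) ℝ)) → r i * γ * (r j)⁻¹ ∈ Gamma0 L := by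
    intro i j hij
    rw [← hrα j, ← map_inv, ← map_mul] at hij
    exact (mapGL_mem_iff _).mp hij
  have hδmem : ∀ i, r i * γ * (r (σ i))⁻¹ ∈ Gamma0 L := fun i ↦ hδmem' i (σ i) (hσ i)
  -- `σ` is a bijection
  have hσinj : Function.Injective σ := by
    intro i j hij
    have hi : r i * γ * (r (σ i))⁻¹ ∈ Gamma0 L := hδmem i
    have hj : r j * γ * (r (σ i))⁻¹ ∈ Gamma0 L := hδmem' j (σ i) (hij ▸ hσ j)
    -- `rᵢ r_j⁻¹ ∈ Γ₀(L)`, so `i = j` by uniqueness for `x = α i`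
    have hij0 : r i * (r j)⁻¹ ∈ Gamma0 L := by
      have := Subgroup.mul_mem _ hi (Subgroup.inv_mem _ hj)
      convert this using 1
      group
    have hij' : α i * (α j)⁻¹ ∈ ((Gamma0 L : Subgroup SL(2, ℤ)) : Subgroup (GL (Fin 2) ℝ)) := by
      rw [← hrα i, ← hrα j, ← map_inv, ← map_mul]
      exact (mapGL_mem_iff _).mpr hij0
    have hαi : α i ∈ DoubleCoset.doubleCoset (1 : GL (Fin 2) ℝ)
        (((Gamma0 L : Subgroup SL(2, ℤ)) : Subgroup (GL (Fin 2) ℝ)))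
        (((Gamma0 N : Subgroup SL(2, ℤ)) : Subgroup (GL (Fin 2) ℝ))) := h.mem i
    exact h.eq_of_mul_inv_mem hαi (by rw [mul_inv_cancel]; exact Subgroup.one_mem _) hij'
  have hσbij : Function.Bijective σ := Finite.injective_iff_bijective.mp hσinj
  refine ⟨fun i ↦ ⟨r i * γ * (r (σ i))⁻¹, hδmem i⟩, fun f ↦ ?_⟩
  -- the trace as a sum of slashes
  have hcoe : (⇑(restrictLevel (Gamma0 L) (Gamma0 N) 2 f) : ℍ → ℂ) =
      ∑ i, (⇑f : ℍ → ℂ) ∣[(2 : ℤ)] (r i) := by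
    rw [coe_restrictLevel_eq_sum 2 _ _ h f]
    exact Finset.sum_congr rfl fun i _ ↦ by rw [← hrα i]; rfl
  set F := restrictLevel (Gamma0 L) (Gamma0 N) 2 f with hF
  set τ₀ : ℍ := UpperHalfPlane.I
  -- `{∞, γ∞}_F = V_F(γτ₀) − V_F(τ₀)`
  have h1 : cuspSymbol F γ = eichlerIntegral F ((γ : SL(2, ℤ)) • τ₀) - eichlerIntegral F τ₀ :=
    (eichlerIntegral_smul_sub_holds F γ τ₀).symm
  -- `V_F(τ) = ∑ᵢ V_{f ∣ rᵢ}(τ)`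
  have h2 : ∀ τ : ℍ, eichlerIntegral F τ = ∑ i, verticalIntegral ((⇑f : ℍ → ℂ) ∣[(2 : ℤ)] (r i)) τ := by
    intro τ
    rw [show eichlerIntegral F = verticalIntegral ⇑F from rfl, hcoe]
    exact verticalIntegral_finset_sum _ _ τ fun i _ ↦ (isCuspFunction_slash f (r i)).integrableOn_ray τ
  -- `V_{f∣rᵢ}(γτ₀) − V_{f∣rᵢ}(τ₀) = V_f(rᵢγτ₀) − V_f(rᵢτ₀)`
  have h3 : ∀ i, verticalIntegral ((⇑f : ℍ → ℂ) ∣[(2 : ℤ)] (r i)) ((γ : SL(2, ℤ)) • τ₀) -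
      verticalIntegral ((⇑f : ℍ → ℂ) ∣[(2 : ℤ)] (r i)) τ₀ =
      eichlerIntegral f ((r i * (γ : SL(2, ℤ))) • τ₀) - eichlerIntegral f (r i • τ₀) := by
    intro i
    have := verticalIntegral_smul_sub_eq (r i) (isCuspFunction_one f) (isCuspFunction_slash f (r i)) τ₀
      ((γ : SL(2, ℤ)) • τ₀)
    rw [show eichlerIntegral f = verticalIntegral ⇑f from rfl, mul_smul]
    linear_combination this
  -- `V_f(rᵢγτ₀) = V_f(r_{σ i}τ₀) + {∞, δᵢ∞}_f`
  have h4 : ∀ i, eichlerIntegral f ((r i * (γ : SL(2, ℤ))) • τ₀) =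
      eichlerIntegral f (r (σ i) • τ₀) + cuspSymbol f ⟨r i * γ * (r (σ i))⁻¹, hδmem i⟩ := by
    intro i
    have := eichlerIntegral_smul_sub_holds f ⟨r i * γ * (r (σ i))⁻¹, hδmem i⟩ (r (σ i) • τ₀)
    have hmul : (r i * (γ : SL(2, ℤ)) * (r (σ i))⁻¹) • (r (σ i) • τ₀) = (r i * (γ : SL(2, ℤ))) • τ₀ := by
      rw [← mul_smul, inv_mul_cancel_right]
    rw [Subgroup.coe_mk, hmul] at this
    linear_combination this
  -- assemble
  rw [h1, h2, h2, ← Finset.sum_sub_distrib]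
  simp_rw [h3, h4]
  rw [Finset.sum_sub_distrib, Finset.sum_add_distrib]
  have hperm : ∑ i, eichlerIntegral f (r (σ i) • τ₀) = ∑ i, eichlerIntegral f (r i • τ₀) :=
    (Equiv.ofBijective σ hσbij).sum_comp (fun i ↦ eichlerIntegral f (r i • τ₀))
  rw [hperm]
  ring

variable (N L) in
/-- **The transfer on period functionals**: for `N ∣ L`, a right coset decomposition `Γ₀(N) = ⊔ᵢ Γ₀(L) rᵢ`
and `γ ∈ Γ₀(N)`, `(Tr^L_N)^∨ {∞, γ∞} = ∑ᵢ {∞, δᵢ∞}` with `δᵢ ∈ Γ₀(L)` (Shimura 1971 (7.2.6)).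
[cite: Shimura1971, §7.2 (7.2.6)] -/
theorem exists_dualMap_restrictLevel_periodFunctional (hNL : N ∣ L)
    (h : IsDoubleCosetDecomp ((Gamma0 L : Subgroup SL(2, ℤ)) : Subgroup (GL (Fin 2) ℝ))
      ((Gamma0 N : Subgroup SL(2, ℤ)) : Subgroup (GL (Fin 2) ℝ)) 1 α) (γ : Gamma0 N) :
    ∃ δ : ι → Gamma0 L,
      (restrictLevel (Gamma0 L) (Gamma0 N) 2).dualMap (periodFunctional N γ) =
        ∑ i, periodFunctional L (δ i) := by
  obtain ⟨δ, hδ⟩ := exists_cuspSymbol_restrictLevel_eq_sum hNL h γ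
  refine ⟨δ, ?_⟩
  ext f
  rw [LinearMap.dualMap_apply, periodFunctional_apply, hδ f]
  simp

variable (N L) in
/-- **The transfer carries `H₁(X₀(N), ℤ)` into `H₁(X₀(L), ℤ)`**: for `N ∣ L` (and any right coset
decomposition of `Γ₀(N)` modulo `Γ₀(L)`, which fixes the trace `Tr^L_N = restrictLevel` as a sum) the transpose of
`Tr^L_N : S₂(Γ₀(L)) → S₂(Γ₀(N))` maps `periodHomology N` into `periodHomology L` — the pull-back
`π^* : H₁(X₀(N), ℤ) → H₁(X₀(L), ℤ)` of cycles along `π : X₀(L) → X₀(N)`, realised inside `S₂^∨`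
(Shimura 1971 §7.2; Cremona 1997 §2.4). [cite: Shimura1971, §7.2 (7.2.6)] -/
theorem dualMap_restrictLevel_mem_periodHomology (hNL : N ∣ L)
    (h : IsDoubleCosetDecomp ((Gamma0 L : Subgroup SL(2, ℤ)) : Subgroup (GL (Fin 2) ℝ))
      ((Gamma0 N : Subgroup SL(2, ℤ)) : Subgroup (GL (Fin 2) ℝ)) 1 α)
    {x : Module.Dual ℂ (CuspForm (Gamma0 N) 2)} (hx : x ∈ periodHomology N) :
    (restrictLevel (Gamma0 L) (Gamma0 N) 2).dualMap x ∈ periodHomology L := by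
  have hx' : x ∈ (periodHomology N : Set (Module.Dual ℂ (CuspForm (Gamma0 N) 2))) := hx
  rw [coe_periodHomology_eq_range] at hx'
  obtain ⟨γ, rfl⟩ := hx'
  obtain ⟨δ, hδ⟩ := exists_dualMap_restrictLevel_periodFunctional N L hNL h γ
  rw [hδ]
  exact sum_mem fun i _ ↦ periodFunctional_mem_periodHomology L (δ i)

end Transfer

end Summit.BirchSwinnertonDyer.BirchSwinnertonDyer.Theorems.LTwistTransfer

end
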